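import Literature.NumberTheory.Automorphic.ArchRankOneSplitOrbitChart                -- ★ FILE 1 (p850131): split-torus descent on `U(Φ₂)(ℂ)`, Bochner rules, `χ⁻ = |·|` over `ℂ`
import Literature.NumberTheory.Automorphic.ArchEndoscopicChartMeasures                 -- ★ `hypBlockGL`, `hypBlockGL_zero`, `hypBlockGL_add`, `continuous_hypBlockGL`
import HarnessLib

/-!
# (A0) The SPLIT side of the central wall of `U(Φ₂)(ℂ) = U(1,1)` at GROUP level: the Weyl-normalised orbital integral over the class of
# `hypBlockGL x θ = diag(e^{x+iθ}, e^{−x+iθ})` is continuous through `x = 0`, with value `C · ∫_{K × N} F(e^{iθ} · k n k⁻¹)` (Rao's cone integral)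

Topic `NumberTheory/Automorphic`; namespace `Literature.NumberTheory.Automorphic.UnitaryGroup`.  KERNEL mathematics only: theorems, no definition, no named fact,
no instance, no notation, no `sorry`.  Cell `pub/hodgecm-mathlib`, line LH3 (closer stub `stub_N9`, crux H413 = `stmt-HodgeConjecture-24833`), DIRECT ROAD brick
**(A0)-U11, GROUP HALF «HAT-BOX-hyp»**, FILE 2 of 2 (FILE 1 = ★ `ArchRankOneSplitOrbitChart`; the chart half in the ball frame is ★ `ArchRankOneHyperbolicKernel` of
LH3-p01 (g3); the elliptic side is ★ (K0±) `ArchRankOneJumpZero` of LH10-p02 (g3)).  Consumers: (J-H) ORDER-0 jump relation (LH10-p02), (I₂@cayPt) (LH5-p04 (g2)),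
(PROD-QUOT-H) (LH3-p03 (g3)).

THE MATHEMATICS (Harish-Chandra; [Varadarajan1989, §6.4 Lemma 21, Thm 23]; [Shelstad1979, Lemma 4.3]; [Rogawski1990, §8.2 p. 119, §3.6 p. 31]).  `G = U(conj, J)(ℂ)` with
`J = Φ₂ = antidiag(1,1)` (a VARIABLE `J` with `hJ : J = (StdForm.antidiagonal 2).over ℂ`, so everything applies verbatim to `archLocal L 2 Φ₂ w`), `T` the SPLIT
(diagonal) Cartan `{diag(λ, λ̄⁻¹)}`, `N = {[[1, y], [0, 1]] : y ∈ iℝ}`, `K ≤ G` any compact subgroup with `G = K·B` and `μ = C • ((k, n) ↦ k n T)_*(κ ⊗ μ_N)` the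
attached invariant measure on `G ⧸ T` (★ FILE 1 `exists_measure_quotient_torusU_complex_two_eq_smul_map`: EVERY non-zero invariant Radon measure is of this form).
The split torus element `t = hypBlockGL x θ = diag(e^{x+iθ}, e^{−x+iθ})` (★ `ArchEndoscopicCartanAtlas`) has `b = d₀⁻¹d₁ = e^{−2x}`, regular iff `x ≠ 0`, and FILE 1
gives `∫_{G ⧸ T} F(y t y⁻¹) dμ = (C |e^{−2x} − 1|⁻¹) • ∫_{K × N} F(k (t n) k⁻¹)`.  Writing `t = z a²`, `z = hypBlockGL 0 θ = e^{iθ}·1` (central), `a = hypBlockGL (x∕2) 0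
= diag(e^{x∕2}, e^{−x∕2}) ∈ T`, the substitution `n ↦ a⁻¹ n a` (module `χ⁻(e^{−x})⁻¹ = eˣ`, ★ FILE 1 `LineRing.map_conj_eq_smul_two` ∕ `skewModulus_conj_eq_nnnorm`) and
`|eˣ − e⁻ˣ| · |e^{−2x} − 1|⁻¹ = eˣ` give, for `x ≠ 0` (§2):
  **`|eˣ − e⁻ˣ| • ∫_{G ⧸ T} F(y · hypBlockGL x θ · y⁻¹) dμ(y) = C • Λ(x)`,  `Λ(x) = ∫_{K × N} F(k · (z · a n a) · k⁻¹) d(κ ⊗ μ_N)`**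
— a chart with NO singularity at `x = 0`: in coordinates `z a n_y a = (e^{x+iθ}, e^{iθ} y; 0, e^{−x+iθ})`.  §3: `Λ` is CONTINUOUS on all of `ℝ` for `F` continuous with
compact support (locally in `x` the integrand lives on a fixed compact of `K × N`, `N` being closed and `K` compact; Mathlib `continuous_parametric_integral_of_continuous`),
and `Λ(0) = ∫_{K × N} F(z · k n k⁻¹)` (`a(0) = 1`, `z` central) — the integral of `F` over the `K`-saturated unipotent cone at the central element `e^{iθ}·1`, BOTH
nappes (`y` runs over all of `iℝ`): Rao's nilpotent-cone integral in `K × N` currency.  HEAD (§4):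
  **`|eˣ − e⁻ˣ| • ∫_{G ⧸ T} F(y · hypBlockGL x θ · y⁻¹) dμ ⟶ C • ∫_{K × N} F(e^{iθ} · k n k⁻¹) d(κ ⊗ μ_N)`  as `x → 0`, `x ≠ 0`**
(`tendsto_abs_sub_smul_integral_descConj_hypBlockGL`) — «`F_f^A` extends continuously to the centre with value the cone integral», the split-side input of the
ORDER-0 jump relation (J-H) whose elliptic side is ★ (K0±).  NOT HERE: the identification of the `K × N` cone functional with the ruled-chart ∕ (K0±) cone value of ★
`ArchRankOneHyperbolicKernel.integral_lineCone_eq_add` ((A0-c), LH10-p02 (g3): take `K = U(Φ₂) ∩ U(2)`), and the Iwasawa decomposition `U(Φ₂)(ℂ) = K·B` feeding `hKB`.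
HONEST LABEL: HC_CM is proved only modulo the 7 printed citations (2 remaining: hLiu418 = stmt-HodgeConjecture-24832, h413 = stmt-HodgeConjecture-24833) until rung 0 closes;
measure theory over Mathlib + ★ FILE 1, count-neutral, pays nothing by itself.

WHAT IS PROVED.  §1 `hypBlockGL_mem_of_eq_over`, `exists_glDiagonal_eq_hypBlockGL` (`b = e^{−2x}`), `hypBlockGL_mem_torusU`, `hypBlockGL_zero_mul_comm`,
`abs_exp_sub_exp_neg_mul_norm_inv`.  §2 `integral_prod_conj_hypBlockGL_half_eq_exp_smul` (the `a`-substitution on `K × N`, every Banach-valued `F`),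
§3 `continuous_integral_prod_conj_hypBlockGL_half`, `integral_prod_conj_hypBlockGL_half_zero`.  §4 `abs_sub_smul_integral_descConj_hypBlockGL_eq_smul_integral_prod`
(the identity off the centre) and the HEAD `tendsto_abs_sub_smul_integral_descConj_hypBlockGL`.

## References
* [Varadarajan1989] V. S. Varadarajan, *An Introduction to Harmonic Analysis on Semisimple Lie Groups*, Cambridge Stud. Adv. Math. 16 (1989), §6.4 Lemma 21, Thm 23.
* [Shelstad1979] D. Shelstad, *Characters and inner forms of a quasi-split group over ℝ*, Compositio Math. 39 (1979), Lemma 4.3 p. 25.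
* [Rogawski1990] J. D. Rogawski, *Automorphic Representations of Unitary Groups in Three Variables*, Ann. of Math. Stud. 123 (1990), §3.6 p. 31, §4.9 p. 55, §8.2 p. 119.
* [Gelbart1975] S. Gelbart, *Automorphic Forms on Adele Groups*, Ann. of Math. Stud. 83, Thm. 9.22 (iii), Remark 9.23. -/

set_option autoImplicit false

noncomputable section

open MeasureTheory Measure Set Filter Topology
open scoped ENNReal NNReal ComplexConjugate

namespace Literature.NumberTheory.Automorphic

open Literature.MeasureTheory.Group

namespace UnitaryGroup

open Literature.NumberTheory.Automorphic.UnitaryGroup.HeisRing Literature.NumberTheory.Automorphic.UnitaryGroup.LineRing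

/-! ## §1 The split torus element `hypBlockGL x θ` inside `U(Φ₂)(ℂ)` -/

section SplitChart

open Literature.NumberTheory.Rogawski1990

variable {J : Matrix (Fin 2) (Fin 2) ℂ} (hJ : J = (StdForm.antidiagonal 2).over ℂ)

include hJ in
/-- **`diag(e^{x+iθ}, e^{−x+iθ}) ∈ U(Φ₂)(ℂ)`** (★ `diag_mem_unitary_antidiag_iff`: `conj(e^{x+iθ}) e^{−x+iθ} = 1`). [cite: Rogawski1990, §3.6 p. 31] -/
theorem hypBlockGL_mem_of_eq_over (x θ : ℝ) : hypBlockGL x θ ∈ unitaryGroupOfForm (starRingEnd ℂ) J := by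
  rw [mem_unitaryGroupOfForm_iff, hJ, StdForm.over_antidiagonal_eq, coe_hypBlockGL]
  exact (diag_mem_unitary_antidiag_iff _ _).2 (conj_exp_mul_exp_eq_one x θ)

/-- `diag(e^{x+iθ}, e^{−x+iθ}) = glDiagonal d` with `d = (e^{x+iθ}, e^{−x+iθ})`, so it lies in the diagonal torus `T`; and `d₀⁻¹d₁ = e^{−2x}`.
[cite: Rogawski1990, §3.6 p. 31] -/
theorem exists_glDiagonal_eq_hypBlockGL (x θ : ℝ) :
    ∃ d : Fin 2 → ℂˣ, glDiagonal 2 ℂ d = hypBlockGL x θ ∧ (((d 0)⁻¹ * d 1 : ℂˣ) : ℂ) = ((Real.exp (-2 * x) : ℝ) : ℂ) := by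
  refine ⟨![Units.mk0 (Complex.exp ((x : ℂ) + (θ : ℂ) * Complex.I)) (Complex.exp_ne_zero _),
    Units.mk0 (Complex.exp (-(x : ℂ) + (θ : ℂ) * Complex.I)) (Complex.exp_ne_zero _)], ?_, ?_⟩
  · refine Matrix.GeneralLinearGroup.ext fun i j => ?_
    rw [coe_glDiagonal, coe_hypBlockGL]
    fin_cases i <;> fin_cases j <;> simp
  · rw [Units.val_mul, Units.val_inv_eq_inv_val]
    simp only [Matrix.cons_val_zero, Matrix.cons_val_one, Matrix.cons_val_fin_one, Units.val_mk0]
    rw [← Complex.exp_neg, ← Complex.exp_add, Complex.ofReal_exp]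
    congr 1
    push_cast
    ring

include hJ in
/-- `diag(e^{x+iθ}, e^{−x+iθ})` lies in the split (diagonal) torus `T = torusU`. [cite: Rogawski1990, §3.6 p. 31] -/
theorem hypBlockGL_mem_torusU (x θ : ℝ) :
    (⟨hypBlockGL x θ, hypBlockGL_mem_of_eq_over hJ x θ⟩ : ↥(unitaryGroupOfForm (starRingEnd ℂ) J)) ∈ torusU (starRingEnd ℂ) J := by
  obtain ⟨d, hd, -⟩ := exists_glDiagonal_eq_hypBlockGL x θ
  exact (mem_torusU_iff _).2 ⟨d, hd⟩

/-- `diag(e^{iθ}, e^{iθ}) = e^{iθ} · 1` is central in `GL₂(ℂ)`. [cite: Rogawski1990, §3.6 p. 31] -/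
theorem hypBlockGL_zero_mul_comm (θ : ℝ) (g : GL (Fin 2) ℂ) : hypBlockGL 0 θ * g = g * hypBlockGL 0 θ := by
  have h : ((hypBlockGL 0 θ : GL (Fin 2) ℂ) : Matrix (Fin 2) (Fin 2) ℂ) = Complex.exp ((θ : ℂ) * Complex.I) • (1 : Matrix (Fin 2) (Fin 2) ℂ) := by
    rw [coe_hypBlockGL]
    ext i j
    fin_cases i <;> fin_cases j <;> simp
  refine Matrix.GeneralLinearGroup.ext fun i j => ?_
  rw [Units.val_mul, Units.val_mul, h, Matrix.smul_mul, Matrix.mul_smul, Matrix.one_mul, Matrix.mul_one]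

/-- The Weyl normalisation: `|eˣ − e⁻ˣ| · |e^{−2x} − 1|⁻¹ = eˣ` for `x ≠ 0`. [cite: Varadarajan1989, §6.4] -/
theorem abs_exp_sub_exp_neg_mul_norm_inv (x : ℝ) (hx : x ≠ 0) :
    |Real.exp x - Real.exp (-x)| * ‖(((Real.exp (-2 * x) : ℝ) : ℂ)) - 1‖⁻¹ = Real.exp x := by
  have hne : Real.exp x - Real.exp (-x) ≠ 0 := by
    intro h
    have h' : x = -x := Real.exp_injective (sub_eq_zero.1 h)
    exact hx (by linarith)
  have hpos : 0 < |Real.exp x - Real.exp (-x)| := abs_pos.2 hne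
  have hfac : Real.exp (-2 * x) - 1 = Real.exp (-x) * (Real.exp (-x) - Real.exp x) := by
    rw [mul_sub, ← Real.exp_add, ← Real.exp_add, neg_add_cancel, Real.exp_zero]
    ring_nf
  rw [← Complex.ofReal_one, ← Complex.ofReal_sub, Complex.norm_real, Real.norm_eq_abs, hfac, abs_mul, abs_of_pos (Real.exp_pos _),
    abs_sub_comm (Real.exp (-x)) (Real.exp x), mul_inv, mul_left_comm, mul_inv_cancel₀ hpos.ne', mul_one, Real.exp_neg, inv_inv]

/-! ## §2 The `a`-substitution on `K × N`; §3 continuity of the chart and its value at the centre -/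

variable [MeasurableSpace ↥(unitaryGroupOfForm (starRingEnd ℂ) J)] [BorelSpace ↥(unitaryGroupOfForm (starRingEnd ℂ) J)]
  {K : Subgroup ↥(unitaryGroupOfForm (starRingEnd ℂ) J)} (κ : Measure ↥K)
  (μN : Measure ↥(unipotentU (starRingEnd ℂ) J)) {E : Type*} [NormedAddCommGroup E] [NormedSpace ℝ E]

include hJ in
/-- **THE SUBSTITUTION `n ↦ a⁻¹ n a`, `a = diag(e^{x∕2}, e^{−x∕2})`, on the `K × N` integral**: `∫_{K×N} F(k (e^{iθ}·a n a) k⁻¹) = eˣ • ∫_{K×N} F(k (t n) k⁻¹)`,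
`t = diag(e^{x+iθ}, e^{−x+iθ}) = e^{iθ} a²` (§1 torus-conjugation rule: `χ⁻(e^{−x})⁻¹ = eˣ`; every Banach-valued `F`, no integrability). [cite: Varadarajan1989, §6.4] -/
theorem integral_prod_conj_hypBlockGL_half_eq_exp_smul [SFinite κ] [IsHaarMeasure μN] (F : ↥(unitaryGroupOfForm (starRingEnd ℂ) J) → E) (x θ : ℝ) :
    ∫ p : ↥K × ↥(unipotentU (starRingEnd ℂ) J),
        F ((p.1 : ↥(unitaryGroupOfForm (starRingEnd ℂ) J)) *
          ((⟨hypBlockGL 0 θ, hypBlockGL_mem_of_eq_over hJ 0 θ⟩ : ↥(unitaryGroupOfForm (starRingEnd ℂ) J)) *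
            (⟨hypBlockGL (x / 2) 0, hypBlockGL_mem_of_eq_over hJ (x / 2) 0⟩ : ↥(unitaryGroupOfForm (starRingEnd ℂ) J)) *
            (p.2 : ↥(unitaryGroupOfForm (starRingEnd ℂ) J)) *
            (⟨hypBlockGL (x / 2) 0, hypBlockGL_mem_of_eq_over hJ (x / 2) 0⟩ : ↥(unitaryGroupOfForm (starRingEnd ℂ) J))) *
          (p.1 : ↥(unitaryGroupOfForm (starRingEnd ℂ) J))⁻¹) ∂(κ.prod μN) =
      Real.exp x • ∫ p : ↥K × ↥(unipotentU (starRingEnd ℂ) J),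
        F ((p.1 : ↥(unitaryGroupOfForm (starRingEnd ℂ) J)) *
          ((⟨hypBlockGL x θ, hypBlockGL_mem_of_eq_over hJ x θ⟩ : ↥(unitaryGroupOfForm (starRingEnd ℂ) J)) *
            (p.2 : ↥(unitaryGroupOfForm (starRingEnd ℂ) J))) *
          (p.1 : ↥(unitaryGroupOfForm (starRingEnd ℂ) J))⁻¹) ∂(κ.prod μN) := by
  haveI : LocallyCompactSpace ↥(unitaryGroupOfForm (starRingEnd ℂ) J) := locallyCompactSpace_unitaryGroupOfForm_complex J
  haveI : SecondCountableTopology ↥(unitaryGroupOfForm (starRingEnd ℂ) J) := secondCountableTopology_unitaryGroupOfForm_complex J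
  have hN : IsClosed (unipotentU (starRingEnd ℂ) J : Set ↥(unitaryGroupOfForm (starRingEnd ℂ) J)) := isClosed_unipotentU _ _
  haveI : LocallyCompactSpace ↥(unipotentU (starRingEnd ℂ) J) := hN.isClosedEmbedding_subtypeVal.locallyCompactSpace
  haveI : SecondCountableTopology ↥(unipotentU (starRingEnd ℂ) J) := TopologicalSpace.Subtype.secondCountableTopology _
  haveI : SecondCountableTopology ↥K := TopologicalSpace.Subtype.secondCountableTopology _
  haveI : BorelSpace ↥(unipotentU (starRingEnd ℂ) J) := Subtype.borelSpace _
  haveI : BorelSpace ↥K := Subtype.borelSpace _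
  haveI : BorelSpace (↥K × ↥(unipotentU (starRingEnd ℂ) J)) := Prod.borelSpace
  -- the half block `a` and its torus data
  set a : ↥(unitaryGroupOfForm (starRingEnd ℂ) J) := ⟨hypBlockGL (x / 2) 0, hypBlockGL_mem_of_eq_over hJ (x / 2) 0⟩ with ha
  set z : ↥(unitaryGroupOfForm (starRingEnd ℂ) J) := ⟨hypBlockGL 0 θ, hypBlockGL_mem_of_eq_over hJ 0 θ⟩ with hz
  set t : ↥(unitaryGroupOfForm (starRingEnd ℂ) J) := ⟨hypBlockGL x θ, hypBlockGL_mem_of_eq_over hJ x θ⟩ with htdef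
  have haT : a ∈ torusU (starRingEnd ℂ) J := hypBlockGL_mem_torusU hJ (x / 2) 0
  obtain ⟨d, hd, hdd⟩ := exists_glDiagonal_eq_hypBlockGL (x / 2) 0
  have hd' : glDiagonal 2 ℂ d = (a : GL (Fin 2) ℂ) := hd
  -- `z a a = t`
  have hzaa : z * a * a = t := by
    apply Subtype.ext
    change hypBlockGL 0 θ * hypBlockGL (x / 2) 0 * hypBlockGL (x / 2) 0 = hypBlockGL x θ
    rw [← hypBlockGL_add, ← hypBlockGL_add, zero_add, add_zero, add_zero, add_halves]
  clear_value a z t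
  -- the module: `χ⁻(e^{−x})⁻¹ = eˣ`
  have hmod : ((skewModulus (starRingEnd ℂ) Complex.continuous_conj ((d 0)⁻¹ * d 1)
      (map_torusScalar_two (starRingEnd ℂ) hJ ⟨a, haT⟩ hd'))⁻¹ : ℝ≥0) = (Real.exp x).toNNReal := by
    rw [skewModulus_conj_eq_nnnorm, hdd]
    apply NNReal.eq
    rw [NNReal.coe_inv, coe_nnnorm, Complex.norm_real, Real.norm_eq_abs, abs_of_pos (Real.exp_pos _), ← Real.exp_neg,
      Real.coe_toNNReal _ (Real.exp_pos _).le]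
    congr 1
    ring
  -- the conjugation homeomorphism on the `N` factor of `K × N`
  obtain ⟨c, hc⟩ := LineRing.exists_homeomorph_torusConj (starRingEnd ℂ) (J := J) haT
  have hce : (c : ↥(unipotentU (starRingEnd ℂ) J) → ↥(unipotentU (starRingEnd ℂ) J)) =
      fun u : ↥(unipotentU (starRingEnd ℂ) J) => (⟨a⁻¹ * u * a, (torus_inv_conj_mem_unipotentU_iff (starRingEnd ℂ) J haT _).2 u.2⟩ :
        ↥(unipotentU (starRingEnd ℂ) J)) := funext hc
  set Ψ : ↥K × ↥(unipotentU (starRingEnd ℂ) J) ≃ₜ ↥K × ↥(unipotentU (starRingEnd ℂ) J) := (Homeomorph.refl ↥K).prodCongr c with hΨ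
  have hΨe : (Ψ : ↥K × ↥(unipotentU (starRingEnd ℂ) J) → ↥K × ↥(unipotentU (starRingEnd ℂ) J)) = Prod.map id c := rfl
  have hmapΨ : (κ.prod μN).map Ψ = (Real.exp x).toNNReal • κ.prod μN := by
    rw [hΨe, ← Measure.map_prod_map _ _ measurable_id c.continuous.measurable, Measure.map_id, hce,
      map_conj_eq_smul_two (starRingEnd ℂ) Complex.continuous_conj hJ μN haT hd', hmod, Measure.prod_smul_right]
  have hint := Ψ.measurableEmbedding.integral_map (μ := κ.prod μN)
    (fun p : ↥K × ↥(unipotentU (starRingEnd ℂ) J) => F ((p.1 : ↥(unitaryGroupOfForm (starRingEnd ℂ) J)) *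
      (t * (p.2 : ↥(unitaryGroupOfForm (starRingEnd ℂ) J))) * (p.1 : ↥(unitaryGroupOfForm (starRingEnd ℂ) J))⁻¹))
  rw [hmapΨ, integral_smul_nnreal_measure] at hint
  have hcG : ∀ u : ↥(unipotentU (starRingEnd ℂ) J), ((c u : ↥(unipotentU (starRingEnd ℂ) J)) : ↥(unitaryGroupOfForm (starRingEnd ℂ) J)) =
      a⁻¹ * (u : ↥(unitaryGroupOfForm (starRingEnd ℂ) J)) * a := fun u => by rw [hc]
  have hcomp : ∀ p : ↥K × ↥(unipotentU (starRingEnd ℂ) J),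
      F ((p.1 : ↥(unitaryGroupOfForm (starRingEnd ℂ) J)) * (z * a * (p.2 : ↥(unitaryGroupOfForm (starRingEnd ℂ) J)) * a) *
          (p.1 : ↥(unitaryGroupOfForm (starRingEnd ℂ) J))⁻¹) =
        F (((Ψ p).1 : ↥(unitaryGroupOfForm (starRingEnd ℂ) J)) * (t * ((Ψ p).2 : ↥(unitaryGroupOfForm (starRingEnd ℂ) J))) *
          ((Ψ p).1 : ↥(unitaryGroupOfForm (starRingEnd ℂ) J))⁻¹) := by
    intro p
    rw [hΨe, Prod.map_fst, Prod.map_snd, id, hcG, ← hzaa]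
    exact congrArg F (by group)
  simp_rw [hcomp]
  rw [← hint, NNReal.smul_def, Real.coe_toNNReal _ (Real.exp_pos _).le]

include hJ in
/-- **(A0), CONTINUITY OF THE CHART.**  For `K` compact, `κ`, `μ_N` Haar and `F` continuous with compact support, the chart integral
`x ↦ ∫_{K × N} F(k · (e^{iθ} · a(x) n a(x)) · k⁻¹) d(κ ⊗ μ_N)`, `a(x) = diag(e^{x∕2}, e^{−x∕2})`, is CONTINUOUS on `ℝ` (through `x = 0`): locally in `x` the integrand
is supported in a fixed compact subset of `K × N` (`N` closed, `K` compact), so Mathlib's `continuous_parametric_integral_of_continuous` applies.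
[cite: Varadarajan1989, §6.4 Thm 23] [cite: Shelstad1979, Lemma 4.3 p. 25] -/
theorem continuous_integral_prod_conj_hypBlockGL_half (hK : IsCompact (K : Set ↥(unitaryGroupOfForm (starRingEnd ℂ) J)))
    [IsHaarMeasure κ] [IsHaarMeasure μN] (F : ↥(unitaryGroupOfForm (starRingEnd ℂ) J) → E) (hF : Continuous F) (hFc : HasCompactSupport F) (θ : ℝ) :
    Continuous fun x : ℝ => ∫ p : ↥K × ↥(unipotentU (starRingEnd ℂ) J),
        F ((p.1 : ↥(unitaryGroupOfForm (starRingEnd ℂ) J)) *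
          ((⟨hypBlockGL 0 θ, hypBlockGL_mem_of_eq_over hJ 0 θ⟩ : ↥(unitaryGroupOfForm (starRingEnd ℂ) J)) *
            (⟨hypBlockGL (x / 2) 0, hypBlockGL_mem_of_eq_over hJ (x / 2) 0⟩ : ↥(unitaryGroupOfForm (starRingEnd ℂ) J)) *
            (p.2 : ↥(unitaryGroupOfForm (starRingEnd ℂ) J)) *
            (⟨hypBlockGL (x / 2) 0, hypBlockGL_mem_of_eq_over hJ (x / 2) 0⟩ : ↥(unitaryGroupOfForm (starRingEnd ℂ) J))) *
          (p.1 : ↥(unitaryGroupOfForm (starRingEnd ℂ) J))⁻¹) ∂(κ.prod μN) := by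
  haveI : LocallyCompactSpace ↥(unitaryGroupOfForm (starRingEnd ℂ) J) := locallyCompactSpace_unitaryGroupOfForm_complex J
  haveI : SecondCountableTopology ↥(unitaryGroupOfForm (starRingEnd ℂ) J) := secondCountableTopology_unitaryGroupOfForm_complex J
  have hN : IsClosed (unipotentU (starRingEnd ℂ) J : Set ↥(unitaryGroupOfForm (starRingEnd ℂ) J)) := isClosed_unipotentU _ _
  haveI : LocallyCompactSpace ↥(unipotentU (starRingEnd ℂ) J) := hN.isClosedEmbedding_subtypeVal.locallyCompactSpace
  haveI : SecondCountableTopology ↥(unipotentU (starRingEnd ℂ) J) := TopologicalSpace.Subtype.secondCountableTopology _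
  haveI : SecondCountableTopology ↥K := TopologicalSpace.Subtype.secondCountableTopology _
  haveI : BorelSpace ↥(unipotentU (starRingEnd ℂ) J) := Subtype.borelSpace _
  haveI : BorelSpace ↥K := Subtype.borelSpace _
  haveI : BorelSpace (↥K × ↥(unipotentU (starRingEnd ℂ) J)) := Prod.borelSpace
  haveI : CompactSpace ↥K := isCompact_iff_compactSpace.1 hK
  haveI : LocallyCompactSpace ↥K := hK.isClosed.isClosedEmbedding_subtypeVal.locallyCompactSpace
  -- the moving torus element `a(x)` and the centre `z`
  set z : ↥(unitaryGroupOfForm (starRingEnd ℂ) J) := ⟨hypBlockGL 0 θ, hypBlockGL_mem_of_eq_over hJ 0 θ⟩ with hz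
  obtain ⟨a, ha⟩ : ∃ a : ℝ → ↥(unitaryGroupOfForm (starRingEnd ℂ) J),
      a = fun x => ⟨hypBlockGL (x / 2) 0, hypBlockGL_mem_of_eq_over hJ (x / 2) 0⟩ := ⟨_, rfl⟩
  have hac : Continuous a := by
    rw [ha]
    exact (continuous_hypBlockGL.comp ((continuous_id.div_const 2).prodMk continuous_const)).subtype_mk _
  -- the integrand as a function of `(x, p)`
  obtain ⟨f, hf⟩ : ∃ f : ℝ → ↥K × ↥(unipotentU (starRingEnd ℂ) J) → E, f = fun x p =>
      F ((p.1 : ↥(unitaryGroupOfForm (starRingEnd ℂ) J)) * (z * a x * (p.2 : ↥(unitaryGroupOfForm (starRingEnd ℂ) J)) * a x) *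
        (p.1 : ↥(unitaryGroupOfForm (starRingEnd ℂ) J))⁻¹) := ⟨_, rfl⟩
  have hgoal : (fun x : ℝ => ∫ p : ↥K × ↥(unipotentU (starRingEnd ℂ) J),
        F ((p.1 : ↥(unitaryGroupOfForm (starRingEnd ℂ) J)) *
          (z * (⟨hypBlockGL (x / 2) 0, hypBlockGL_mem_of_eq_over hJ (x / 2) 0⟩ : ↥(unitaryGroupOfForm (starRingEnd ℂ) J)) *
            (p.2 : ↥(unitaryGroupOfForm (starRingEnd ℂ) J)) *
            (⟨hypBlockGL (x / 2) 0, hypBlockGL_mem_of_eq_over hJ (x / 2) 0⟩ : ↥(unitaryGroupOfForm (starRingEnd ℂ) J))) *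
          (p.1 : ↥(unitaryGroupOfForm (starRingEnd ℂ) J))⁻¹) ∂(κ.prod μN)) = fun x => ∫ p, f x p ∂(κ.prod μN) := by
    rw [hf, ha]
  rw [hgoal]
  have hfc : Continuous f.uncurry := by
    rw [hf]
    refine hF.comp ?_
    have h1 : Continuous fun q : ℝ × (↥K × ↥(unipotentU (starRingEnd ℂ) J)) => ((q.2.1 : ↥K) : ↥(unitaryGroupOfForm (starRingEnd ℂ) J)) :=
      continuous_subtype_val.comp (continuous_fst.comp continuous_snd)
    have h2 : Continuous fun q : ℝ × (↥K × ↥(unipotentU (starRingEnd ℂ) J)) =>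
        ((q.2.2 : ↥(unipotentU (starRingEnd ℂ) J)) : ↥(unitaryGroupOfForm (starRingEnd ℂ) J)) :=
      continuous_subtype_val.comp (continuous_snd.comp continuous_snd)
    have h3 : Continuous fun q : ℝ × (↥K × ↥(unipotentU (starRingEnd ℂ) J)) => a q.1 := hac.comp continuous_fst
    exact ((h1.mul (((continuous_const.mul h3).mul h2).mul h3)).mul h1.inv)
  refine continuous_iff_continuousAt.2 fun x₀ => ?_
  -- a compact set of `N` carrying the support for `x ∈ [x₀ − 1, x₀ + 1]`
  obtain ⟨Ψ, hΨ⟩ : ∃ Ψ : ℝ × ↥K × ↥(unitaryGroupOfForm (starRingEnd ℂ) J) → ↥(unitaryGroupOfForm (starRingEnd ℂ) J),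
      Ψ = fun q => (z * a q.1)⁻¹ * (((q.2.1 : ↥K) : ↥(unitaryGroupOfForm (starRingEnd ℂ) J))⁻¹ * q.2.2 *
        ((q.2.1 : ↥K) : ↥(unitaryGroupOfForm (starRingEnd ℂ) J))) * (a q.1)⁻¹ := ⟨_, rfl⟩
  have hΨc : Continuous Ψ := by
    rw [hΨ]
    have h1 : Continuous fun q : ℝ × ↥K × ↥(unitaryGroupOfForm (starRingEnd ℂ) J) => ((q.2.1 : ↥K) : ↥(unitaryGroupOfForm (starRingEnd ℂ) J)) :=
      continuous_subtype_val.comp (continuous_fst.comp continuous_snd)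
    have h3 : Continuous fun q : ℝ × ↥K × ↥(unitaryGroupOfForm (starRingEnd ℂ) J) => a q.1 := hac.comp continuous_fst
    exact ((continuous_const.mul h3).inv.mul ((h1.inv.mul (continuous_snd.comp continuous_snd)).mul h1)).mul h3.inv
  set S₁ : Set ↥(unitaryGroupOfForm (starRingEnd ℂ) J) := Ψ '' (Icc (x₀ - 1) (x₀ + 1) ×ˢ (univ ×ˢ tsupport F)) with hS₁
  have hS₁c : IsCompact S₁ := ((isCompact_Icc.prod (isCompact_univ.prod hFc)).image hΨc)
  set N₀ : Set ↥(unipotentU (starRingEnd ℂ) J) := Subtype.val ⁻¹' S₁ with hN₀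
  have hN₀c : IsCompact N₀ := hN.isClosedEmbedding_subtypeVal.isCompact_preimage hS₁c
  set s : Set (↥K × ↥(unipotentU (starRingEnd ℂ) J)) := univ ×ˢ N₀ with hs
  have hsc : IsCompact s := isCompact_univ.prod hN₀c
  -- off `s` the integrand vanishes, for `x` near `x₀`
  have hzero : ∀ x ∈ Icc (x₀ - 1) (x₀ + 1), ∀ p, p ∉ s → f x p = 0 := by
    intro x hx p hp
    rw [hf]
    by_contra hne
    apply hp
    refine mk_mem_prod (mem_univ _) ?_
    change ((p.2 : ↥(unipotentU (starRingEnd ℂ) J)) : ↥(unitaryGroupOfForm (starRingEnd ℂ) J)) ∈ S₁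
    refine ⟨(x, p.1, (p.1 : ↥(unitaryGroupOfForm (starRingEnd ℂ) J)) * (z * a x * (p.2 : ↥(unitaryGroupOfForm (starRingEnd ℂ) J)) * a x) *
      (p.1 : ↥(unitaryGroupOfForm (starRingEnd ℂ) J))⁻¹), mk_mem_prod hx (mk_mem_prod (mem_univ _) (subset_tsupport _ hne)), ?_⟩
    rw [hΨ]
    simp only
    group
  -- the parametric integral over the compact `s` is continuous, and agrees with ours near `x₀`
  have hcont : Continuous fun x => ∫ p in s, f x p ∂(κ.prod μN) := continuous_parametric_integral_of_continuous hfc hsc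
  refine (hcont.continuousAt (x := x₀)).congr ?_
  filter_upwards [Icc_mem_nhds (show x₀ - 1 < x₀ by linarith) (show x₀ < x₀ + 1 by linarith)] with x hx
  exact setIntegral_eq_integral_of_forall_compl_eq_zero fun p hp => hzero x hx p hp

omit [BorelSpace ↥(unitaryGroupOfForm (starRingEnd ℂ) J)] in
include hJ in
/-- **(A0), THE VALUE AT THE CENTRE**: at `x = 0` the chart integral is `∫_{K × N} F(e^{iθ} · k n k⁻¹) d(κ ⊗ μ_N)` — the integral of `F` over the `K`-saturated
unipotent cone at the central element `e^{iθ}·1` (Rao's nilpotent-cone integral, both nappes: `n` runs over all of `N ≅ iℝ`). [cite: Varadarajan1989, §6.4 Thm 23] -/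
theorem integral_prod_conj_hypBlockGL_half_zero (F : ↥(unitaryGroupOfForm (starRingEnd ℂ) J) → E) (θ : ℝ) :
    ∫ p : ↥K × ↥(unipotentU (starRingEnd ℂ) J),
        F ((p.1 : ↥(unitaryGroupOfForm (starRingEnd ℂ) J)) *
          ((⟨hypBlockGL 0 θ, hypBlockGL_mem_of_eq_over hJ 0 θ⟩ : ↥(unitaryGroupOfForm (starRingEnd ℂ) J)) *
            (⟨hypBlockGL ((0 : ℝ) / 2) 0, hypBlockGL_mem_of_eq_over hJ ((0 : ℝ) / 2) 0⟩ : ↥(unitaryGroupOfForm (starRingEnd ℂ) J)) *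
            (p.2 : ↥(unitaryGroupOfForm (starRingEnd ℂ) J)) *
            (⟨hypBlockGL ((0 : ℝ) / 2) 0, hypBlockGL_mem_of_eq_over hJ ((0 : ℝ) / 2) 0⟩ : ↥(unitaryGroupOfForm (starRingEnd ℂ) J))) *
          (p.1 : ↥(unitaryGroupOfForm (starRingEnd ℂ) J))⁻¹) ∂(κ.prod μN) =
      ∫ p : ↥K × ↥(unipotentU (starRingEnd ℂ) J),
        F ((⟨hypBlockGL 0 θ, hypBlockGL_mem_of_eq_over hJ 0 θ⟩ : ↥(unitaryGroupOfForm (starRingEnd ℂ) J)) *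
          ((p.1 : ↥(unitaryGroupOfForm (starRingEnd ℂ) J)) * (p.2 : ↥(unitaryGroupOfForm (starRingEnd ℂ) J)) *
            (p.1 : ↥(unitaryGroupOfForm (starRingEnd ℂ) J))⁻¹)) ∂(κ.prod μN) := by
  have h1 : (⟨hypBlockGL ((0 : ℝ) / 2) 0, hypBlockGL_mem_of_eq_over hJ ((0 : ℝ) / 2) 0⟩ : ↥(unitaryGroupOfForm (starRingEnd ℂ) J)) = 1 := by
    apply Subtype.ext
    change hypBlockGL (0 / 2) 0 = 1
    rw [zero_div, hypBlockGL_zero]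
  have hzk : ∀ k : ↥(unitaryGroupOfForm (starRingEnd ℂ) J),
      k * (⟨hypBlockGL 0 θ, hypBlockGL_mem_of_eq_over hJ 0 θ⟩ : ↥(unitaryGroupOfForm (starRingEnd ℂ) J)) =
        (⟨hypBlockGL 0 θ, hypBlockGL_mem_of_eq_over hJ 0 θ⟩ : ↥(unitaryGroupOfForm (starRingEnd ℂ) J)) * k :=
    fun k => Subtype.ext ((hypBlockGL_zero_mul_comm θ (k : GL (Fin 2) ℂ)).symm)
  refine integral_congr_ae (Eventually.of_forall fun p => ?_)
  simp only [h1, mul_one]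
  rw [← mul_assoc, hzk, mul_assoc, mul_assoc, mul_assoc]

/-! ## §4 (A0): the identity off the centre and the limit at the centre -/

variable [MeasurableSpace (↥(unitaryGroupOfForm (starRingEnd ℂ) J) ⧸ torusU (starRingEnd ℂ) J)]
  [BorelSpace (↥(unitaryGroupOfForm (starRingEnd ℂ) J) ⧸ torusU (starRingEnd ℂ) J)]
  (μ : Measure (↥(unitaryGroupOfForm (starRingEnd ℂ) J) ⧸ torusU (starRingEnd ℂ) J))

include hJ in
/-- **(A0), THE IDENTITY OFF THE CENTRE.**  For `x ≠ 0`, `μ = C • ((k, n) ↦ k n T)_*(κ ⊗ μ_N)` on `U(Φ₂)(ℂ) ⧸ T` and every continuous Banach-valued `F`: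
**`|eˣ − e⁻ˣ| • ∫_{G ⧸ T} F(y · diag(e^{x+iθ}, e^{−x+iθ}) · y⁻¹) dμ(y) = C • ∫_{K × N} F(k · (e^{iθ} · a n a) · k⁻¹) d(κ ⊗ μ_N)`**, `a = diag(e^{x∕2}, e^{−x∕2})` — the
Weyl-normalised split orbital integral in a chart with NO singularity at `x = 0` (§3 descent with module `|e^{−2x} − 1|⁻¹`, `|eˣ − e⁻ˣ|·|e^{−2x} − 1|⁻¹ = eˣ`,
and the substitution `n ↦ a⁻¹ n a` of module `eˣ`).  Harish-Chandra's `F_f^A` for `U(1,1)`. [cite: Varadarajan1989, §6.4 Lemma 21, Thm 23] [cite: Rogawski1990, §8.2 p. 119] -/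
theorem abs_sub_smul_integral_descConj_hypBlockGL_eq_smul_integral_prod [SFinite κ] [IsHaarMeasure μN] {C : ℝ≥0}
    (hμC : μ = C • Measure.map
      (fun p : ↥K × ↥(unipotentU (starRingEnd ℂ) J) =>
        (QuotientGroup.mk ((p.1 : ↥(unitaryGroupOfForm (starRingEnd ℂ) J)) * (p.2 : ↥(unitaryGroupOfForm (starRingEnd ℂ) J))) :
          ↥(unitaryGroupOfForm (starRingEnd ℂ) J) ⧸ torusU (starRingEnd ℂ) J))
      (κ.prod μN))
    (F : ↥(unitaryGroupOfForm (starRingEnd ℂ) J) → E) (hF : Continuous F) (θ : ℝ) {x : ℝ} (hx : x ≠ 0) :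
    |Real.exp x - Real.exp (-x)| •
        ∫ y, descConj (⟨hypBlockGL x θ, hypBlockGL_mem_of_eq_over hJ x θ⟩ : ↥(unitaryGroupOfForm (starRingEnd ℂ) J)) (torusU (starRingEnd ℂ) J)
          (LineRing.forall_mem_torusU_comm (starRingEnd ℂ) J (hypBlockGL_mem_torusU hJ x θ)) F y ∂μ =
      (C : ℝ) • ∫ p : ↥K × ↥(unipotentU (starRingEnd ℂ) J),
        F ((p.1 : ↥(unitaryGroupOfForm (starRingEnd ℂ) J)) *
          ((⟨hypBlockGL 0 θ, hypBlockGL_mem_of_eq_over hJ 0 θ⟩ : ↥(unitaryGroupOfForm (starRingEnd ℂ) J)) *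
            (⟨hypBlockGL (x / 2) 0, hypBlockGL_mem_of_eq_over hJ (x / 2) 0⟩ : ↥(unitaryGroupOfForm (starRingEnd ℂ) J)) *
            (p.2 : ↥(unitaryGroupOfForm (starRingEnd ℂ) J)) *
            (⟨hypBlockGL (x / 2) 0, hypBlockGL_mem_of_eq_over hJ (x / 2) 0⟩ : ↥(unitaryGroupOfForm (starRingEnd ℂ) J))) *
          (p.1 : ↥(unitaryGroupOfForm (starRingEnd ℂ) J))⁻¹) ∂(κ.prod μN) := by
  obtain ⟨d, hd, hdd⟩ := exists_glDiagonal_eq_hypBlockGL x θ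
  have hd' : glDiagonal 2 ℂ d = (((⟨hypBlockGL x θ, hypBlockGL_mem_of_eq_over hJ x θ⟩ : ↥(unitaryGroupOfForm (starRingEnd ℂ) J))) : GL (Fin 2) ℂ) := hd
  have hb : (((d 0)⁻¹ * d 1 : ℂˣ) : ℂ) ≠ 1 := by
    rw [hdd, ← Complex.ofReal_one, Ne, Complex.ofReal_inj, Real.exp_eq_one_iff]
    intro h
    exact hx (by linarith)
  rw [integral_descConj_torusU_complex_two_regular_eq_smul_integral_prod hJ κ μN μ hμC (hypBlockGL_mem_torusU hJ x θ) hd' hb F hF,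
    integral_prod_conj_hypBlockGL_half_eq_exp_smul hJ κ μN F x θ, smul_smul, smul_smul, hdd]
  congr 1
  rw [mul_comm (C : ℝ) (‖(((Real.exp (-2 * x) : ℝ) : ℂ)) - 1‖⁻¹), ← mul_assoc, abs_exp_sub_exp_neg_mul_norm_inv x hx, mul_comm]

include hJ in
/-- **(A0) HEAD — THE SPLIT SIDE OF THE CENTRAL WALL OF `U(1,1)` AT GROUP LEVEL.**  For every compact `K ≤ U(Φ₂)(ℂ)` with `U(Φ₂)(ℂ) = K·B`-normalised invariant measure
`μ = C • ((k, n) ↦ k n T)_*(κ ⊗ μ_N)` on `U(Φ₂)(ℂ) ⧸ T` (§3: EVERY non-zero invariant Radon `μ` has this form), every continuous compactly supported Banach-valued `F`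
and every `θ`: the Weyl-normalised orbital integral over the class of the split-torus element `diag(e^{x+iθ}, e^{−x+iθ})`,
`x ↦ |eˣ − e⁻ˣ| · ∫_{G ⧸ T} F(y · diag(e^{x+iθ}, e^{−x+iθ}) · y⁻¹) dμ(y)`, tends as `x → 0`, `x ≠ 0`, to **`C • ∫_{K × N} F(e^{iθ} · k n k⁻¹) d(κ ⊗ μ_N)`** — Harish-Chandra:
`F_f^A` extends continuously to the centre with value Rao's (two-nappe) cone integral. [cite: Varadarajan1989, §6.4 Lemma 21, Thm 23] [cite: Shelstad1979, Lemma 4.3 p. 25]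
[cite: Rogawski1990, §8.2 p. 119] -/
theorem tendsto_abs_sub_smul_integral_descConj_hypBlockGL (hK : IsCompact (K : Set ↥(unitaryGroupOfForm (starRingEnd ℂ) J)))
    [IsHaarMeasure κ] [IsHaarMeasure μN] {C : ℝ≥0}
    (hμC : μ = C • Measure.map
      (fun p : ↥K × ↥(unipotentU (starRingEnd ℂ) J) =>
        (QuotientGroup.mk ((p.1 : ↥(unitaryGroupOfForm (starRingEnd ℂ) J)) * (p.2 : ↥(unitaryGroupOfForm (starRingEnd ℂ) J))) :
          ↥(unitaryGroupOfForm (starRingEnd ℂ) J) ⧸ torusU (starRingEnd ℂ) J))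
      (κ.prod μN))
    (F : ↥(unitaryGroupOfForm (starRingEnd ℂ) J) → E) (hF : Continuous F) (hFc : HasCompactSupport F) (θ : ℝ) :
    Tendsto (fun x : ℝ => |Real.exp x - Real.exp (-x)| •
        ∫ y, descConj (⟨hypBlockGL x θ, hypBlockGL_mem_of_eq_over hJ x θ⟩ : ↥(unitaryGroupOfForm (starRingEnd ℂ) J)) (torusU (starRingEnd ℂ) J)
          (LineRing.forall_mem_torusU_comm (starRingEnd ℂ) J (hypBlockGL_mem_torusU hJ x θ)) F y ∂μ)
      (𝓝[≠] 0)
      (𝓝 ((C : ℝ) • ∫ p : ↥K × ↥(unipotentU (starRingEnd ℂ) J),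
        F ((⟨hypBlockGL 0 θ, hypBlockGL_mem_of_eq_over hJ 0 θ⟩ : ↥(unitaryGroupOfForm (starRingEnd ℂ) J)) *
          ((p.1 : ↥(unitaryGroupOfForm (starRingEnd ℂ) J)) * (p.2 : ↥(unitaryGroupOfForm (starRingEnd ℂ) J)) *
            (p.1 : ↥(unitaryGroupOfForm (starRingEnd ℂ) J))⁻¹)) ∂(κ.prod μN))) := by
  haveI : CompactSpace ↥K := isCompact_iff_compactSpace.1 hK
  have hcont := continuous_integral_prod_conj_hypBlockGL_half hJ κ μN hK F hF hFc θ
  have h0 := integral_prod_conj_hypBlockGL_half_zero hJ κ μN F θ (K := K) (E := E)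
  have hlim := ((hcont.tendsto 0).const_smul (C : ℝ)).mono_left (nhdsWithin_le_nhds (s := ({0}ᶜ : Set ℝ)))
  rw [h0] at hlim
  refine hlim.congr' ?_
  filter_upwards [self_mem_nhdsWithin] with x hx
  exact (abs_sub_smul_integral_descConj_hypBlockGL_eq_smul_integral_prod hJ κ μN μ hμC F hF θ hx).symm

end SplitChart

end UnitaryGroup

end Literature.NumberTheory.Automorphic

end
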